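import Mathlib
import Summits.ValiantsHypothesis.ValiantsHypothesis.Theses.BarrierLever
import Summits.ValiantsHypothesis.ValiantsHypothesis.Theorems.BarrierLeverPartitionMinorsHitByVPHiddenStates

/-!
# Route BarrierLever — item `PartitionMinorsHitByVP` (stmt-ValiantsHypothesis-19717):
# the JOIN DOOR — a SUM of hidden-cube witnesses realises every disjoint union of threshold families

Helper file (`--supports stmt-ValiantsHypothesis-19717`; cell valiant-natproofs, rung V4, 𝒟-side of
door (c); prover seat val-np-p3 gen 8). Definition-free. Closes NO item.

The hidden-state door (`HiddenStates.partitionMinor_hit_of_hiddenStates`, val-np-p3 g6) uses ONE product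
`F(tab, λ) = ∏_v (1 + tab none v X_v) · ∏_k (1 + λ_k ∏_v (1 + tab (some k) v X_v))` with `K` hidden states;
its hidden family is the set of the `r` lightest subsets of `Fin K` for an additive weight, hence always a
down-set of ONE cube — for `r` between two complete Hamming balls its top layer is a colex-initial segment
carried by few states, the source of the star/biclique obstruction (`…HiddenStatesStar`, K(h) ≳ h²/11).

THIS door sums `m` such witnesses with INDEPENDENT tables and weights, scaled by `C (κ_i)`:
`F = Σ_{i<m} κ_i · F(tab_i, λ_i)`. On a layout `(u, w)` its partition matrix is
`Σ_{(i,J)} κ_i λ_i^J · A[(i,J)] · B[(i,J)]` over the DISJOINT UNION of the `m` cubes (`Fin m × Finset (Fin K)`,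
`coeff_partition_joinWitness`), and with `κ_i = t₀^{W i}`, `λ_{ik} = t₀^{wt i k}` the Cauchy–Binet leading term
of `HiddenStates.exists_eval_det_hiddenSum_ne_zero` (stated there for an arbitrary finite index type) applies
verbatim: the hidden family may now be ANY `e : Fin r → Fin m × Finset (Fin K)` that is a threshold family
for the weight `(i,J) ↦ W i + Σ_{k∈J} wt i k` — i.e. an arbitrary JOIN (disjoint union, affinely independent
pieces, one generic affine table per piece) `P = P_0 ⊔ … ⊔ P_{m-1}` of per-cube threshold families whose sizes
add up to `r`. In particular `r = Σ_i |B_{s_i}(K)| + (simplex)` is realised with every piece a COMPLETE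
Hamming ball (no partial layer anywhere) for every `r ≤ 2^h` with `m ≤ h+1` pieces and `K ≤ 2h`.

* `coeff_partition_joinWitness` — the partition matrix of the sum (linearity + `coeff_partition_hiddenStateF`).
* `complexity_joinWitness_le` — size `≤ m · (6h + K(6h+2) + K + 3) + m`.
* **`partitionMinor_hit_of_hiddenJoin`** (THE JOIN DOOR, explicit size) and
  **`partitionMinor_hit_of_hiddenJoin_mem`** (`m ≤ 2h`, `K ≤ 2h`, `h ≥ 3` ⇒ inside `SmallCircuits ℂ (h+h) 7`):
  if BOTH block-additive matrices `[∏_{a∈u i} (tx p none a + Σ_{q∈J} tx p (some q) a)]_{i,(p,J)=e k}` and the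
  `y`-analogue are nonsingular for some tables, the layout is hit.
* `partitionMinor_hit_of_hiddenJoin_mem'` / `partitionMinorsHitByVP_of_universalJoin'` — the same with up to `h·h` pieces (`b = 8`).
* **`partitionMinorsHitByVP_of_universalJoin`** — the item BY NAME from: «for all `h ≥ h₁` and `r ≤ 2^h` there is
  ONE join threshold family of size `r` (`m, K ≤ 2h`) against which EVERY injective row family on `Fin h` has a
  nonsingular block-additive matrix for some table» (`b = 7`).

CONJECTURE OF THIS SEAT (memo HOME/val-np-p3/g8/MEMO-joins-completeballs-valnp3-g8.md; census kit j287348 /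
j287349 / j287352): the greedy join of COMPLETE balls `B_{s_1}(K_1) ⊔ … ⊔ B_{s_m}(K_m) ⊔ Δ` (`h ≤ K_i ≤ 2h`) is
such a family («CB»: a complete ball `B_s(K)`, `K ≥ h`, is good for EVERY family of `|B_s(K)|` subsets of
`Fin h` — exhaustive over lower sets at `h ≤ 5`, 0 failures in all sampled adversarial/random families at
`h ≤ 9`; plus the Plücker non-cancellation between independent pieces, verified at `h = 4`). WHAT THIS IS NOT:
no family is proved universal here beyond what the hypotheses give; item 19717 stays OPEN; nothing on CPM
(20172/20195), crux 14610 or VP vs VNP.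
-/

set_option linter.dupNamespace false

namespace Summit.ValiantsHypothesis.ValiantsHypothesis.Theorems.BarrierLever.HiddenStates

open Finset MvPolynomial Matrix
open Literature.Barriers.ValiantsHypothesis Literature.Computability.AlgebraicComplexity
open Summit.ValiantsHypothesis.ValiantsHypothesis.Theorems.BarrierLever.AdditiveDoor
  (truncation_spec degree_partitionExpo_le complexity_one_add_C_mul_X_le)

noncomputable section

section Join

variable {h : ℕ}

/-- **The partition matrix of the join witness.** On a layout `(U, W)` the coefficient of `x^U y^W` in
`Σ_i κ_i · F(tab_i, λ_i)` is `Σ_i Σ_J κ_i λ_i^J · (∏_{a∈U} (tab_i none x_a + Σ_{k∈J} tab_i k x_a)) · (y-analogue)`. -/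
theorem coeff_partition_joinWitness {m K : ℕ} (tab : Fin m → Option (Fin K) → Fin (h + h) → ℂ)
    (lam : Fin m → Fin K → ℂ) (kap : Fin m → ℂ) (U W : Finset (Fin h)) :
    coeff (∑ a ∈ U, Finsupp.single (Fin.castAdd h a) 1 + ∑ c ∈ W, Finsupp.single (Fin.natAdd h c) 1)
      (∑ i : Fin m, C (kap i) * ((∏ v : Fin (h + h), (1 + C (tab i none v) * X v)) *
        ∏ k : Fin K, (1 + C (lam i k) * ∏ v : Fin (h + h), (1 + C (tab i (some k) v) * X v))) :
        MvPolynomial (Fin (h + h)) ℂ) =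
      ∑ i : Fin m, ∑ J : Finset (Fin K), kap i * (∏ k ∈ J, lam i k) *
        ((∏ a ∈ U, (tab i none (Fin.castAdd h a) + ∑ k ∈ J, tab i (some k) (Fin.castAdd h a))) *
          ∏ c ∈ W, (tab i none (Fin.natAdd h c) + ∑ k ∈ J, tab i (some k) (Fin.natAdd h c))) := by
  rw [coeff_sum]
  refine Finset.sum_congr rfl fun i _ => ?_
  rw [coeff_C_mul, coeff_partition_hiddenStateF, Finset.mul_sum]
  refine Finset.sum_congr rfl fun J _ => ?_
  ring

/-- **Size of the join witness**: `L(Σ_{i<m} κ_i F(tab_i, λ_i)) ≤ m · (3(2h) + K(3(2h)+2) + K + 3) + m`. -/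
theorem complexity_joinWitness_le {m K : ℕ} (tab : Fin m → Option (Fin K) → Fin (h + h) → ℂ)
    (lam : Fin m → Fin K → ℂ) (kap : Fin m → ℂ) :
    complexity (∑ i : Fin m, C (kap i) * ((∏ v : Fin (h + h), (1 + C (tab i none v) * X v)) *
        ∏ k : Fin K, (1 + C (lam i k) * ∏ v : Fin (h + h), (1 + C (tab i (some k) v) * X v))) :
        MvPolynomial (Fin (h + h)) ℂ) ≤
      m * (3 * (h + h) + (K * (3 * (h + h) + 2) + K) + 1 + 2) + m := by
  have hterm : ∀ i : Fin m, complexity (C (kap i) * ((∏ v : Fin (h + h), (1 + C (tab i none v) * X v)) *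
        ∏ k : Fin K, (1 + C (lam i k) * ∏ v : Fin (h + h), (1 + C (tab i (some k) v) * X v))) :
        MvPolynomial (Fin (h + h)) ℂ) ≤ 3 * (h + h) + (K * (3 * (h + h) + 2) + K) + 1 + 2 := by
    intro i
    calc complexity (C (kap i) * ((∏ v : Fin (h + h), (1 + C (tab i none v) * X v)) *
          ∏ k : Fin K, (1 + C (lam i k) * ∏ v : Fin (h + h), (1 + C (tab i (some k) v) * X v))) :
          MvPolynomial (Fin (h + h)) ℂ)
        ≤ complexity (C (kap i) : MvPolynomial (Fin (h + h)) ℂ) +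
            complexity ((∏ v : Fin (h + h), (1 + C (tab i none v) * X v)) *
              ∏ k : Fin K, (1 + C (lam i k) * ∏ v : Fin (h + h), (1 + C (tab i (some k) v) * X v)) :
              MvPolynomial (Fin (h + h)) ℂ) + 1 := complexity_mul_le_holds _ _
      _ ≤ 0 + (3 * (h + h) + (K * (3 * (h + h) + 2) + K) + 1) + 1 := by
          rw [complexity_C_holds]
          gcongr
          exact complexity_hiddenStateF_le (tab i) (lam i)
      _ = 3 * (h + h) + (K * (3 * (h + h) + 2) + K) + 1 + 1 := by ring
      _ ≤ _ := by omega
  calc complexity (∑ i : Fin m, C (kap i) * ((∏ v : Fin (h + h), (1 + C (tab i none v) * X v)) *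
        ∏ k : Fin K, (1 + C (lam i k) * ∏ v : Fin (h + h), (1 + C (tab i (some k) v) * X v))) :
        MvPolynomial (Fin (h + h)) ℂ)
      ≤ ∑ i : Fin m, complexity (C (kap i) * ((∏ v : Fin (h + h), (1 + C (tab i none v) * X v)) *
          ∏ k : Fin K, (1 + C (lam i k) * ∏ v : Fin (h + h), (1 + C (tab i (some k) v) * X v))) :
          MvPolynomial (Fin (h + h)) ℂ) + (Finset.univ : Finset (Fin m)).card :=
        complexity_finset_sum_le _ _
    _ ≤ ∑ _i : Fin m, (3 * (h + h) + (K * (3 * (h + h) + 2) + K) + 1 + 2) +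
          (Finset.univ : Finset (Fin m)).card := by gcongr with i _; exact hterm i
    _ = m * (3 * (h + h) + (K * (3 * (h + h) + 2) + K) + 1 + 2) + m := by simp

/-- **THE JOIN DOOR (explicit size).** Let `(u, w)` be a layout of size `r`, `e : Fin r → Fin m × Finset (Fin K)`
an injective THRESHOLD family of the disjoint union of `m` hidden cubes for the additive weight
`(p, J) ↦ W p + Σ_{k∈J} wt p k` (every state outside its range is heavier than every member), and
`tx, ty : Fin m → Option (Fin K) → Fin h → ℂ` tables (one per piece) whose block-additive matrices
`[∏_{a ∈ u i} (tx p none a + Σ_{q ∈ J} tx p (some q) a)]_{i, (p,J) = e k}` and the `y`-analogue are BOTH nonsingular.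
Then some `f` of degree `≤ 2h` and size `≤ (2h+2)² (m (6h + K(6h+2) + K + 3) + m) + 2h + 1` has a nonsingular
partition matrix on `(u, w)`. -/
theorem partitionMinor_hit_of_hiddenJoin (h m K r : ℕ) (u w : Fin r → Finset (Fin h))
    (e : Fin r → Fin m × Finset (Fin K)) (he : Function.Injective e) (W : Fin m → ℕ) (wt : Fin m → Fin K → ℕ)
    (hthr : ∀ x : Fin m × Finset (Fin K), x ∉ Set.range e →
      ∀ i, W (e i).1 + ∑ k ∈ (e i).2, wt (e i).1 k < W x.1 + ∑ k ∈ x.2, wt x.1 k)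
    (tx ty : Fin m → Option (Fin K) → Fin h → ℂ)
    (hx : (Matrix.of fun i k : Fin r =>
      ∏ a ∈ u i, (tx (e k).1 none a + ∑ q ∈ (e k).2, tx (e k).1 (some q) a)).det ≠ 0)
    (hy : (Matrix.of fun j k : Fin r =>
      ∏ c ∈ w j, (ty (e k).1 none c + ∑ q ∈ (e k).2, ty (e k).1 (some q) c)).det ≠ 0) :
    ∃ f : MvPolynomial (Fin (h + h)) ℂ, f.totalDegree ≤ h + h ∧
      complexity f ≤ (h + h + 2) ^ 2 * (m * (3 * (h + h) + (K * (3 * (h + h) + 2) + K) + 1 + 2) + m) +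
        (h + h + 1) ∧
      (Matrix.of fun i j : Fin r => MvPolynomial.coeff
        (∑ a ∈ u i, Finsupp.single (Fin.castAdd h a) 1 +
          ∑ c ∈ w j, Finsupp.single (Fin.natAdd h c) 1) f).det ≠ 0 := by
  classical
  -- the two block-additive matrices over ALL hidden states of the disjoint union
  set A : Matrix (Fin r) (Fin m × Finset (Fin K)) ℂ :=
    Matrix.of fun i x => ∏ a ∈ u i, (tx x.1 none a + ∑ q ∈ x.2, tx x.1 (some q) a) with hA
  set B : Matrix (Fin r) (Fin m × Finset (Fin K)) ℂ :=
    Matrix.of fun j x => ∏ c ∈ w j, (ty x.1 none c + ∑ q ∈ x.2, ty x.1 (some q) c) with hB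
  set ω : Fin m × Finset (Fin K) → ℕ := fun x => W x.1 + ∑ k ∈ x.2, wt x.1 k with hω
  have hAe : (A.submatrix id e).det ≠ 0 := hx
  have hBe : (B.submatrix id e).det ≠ 0 := hy
  have hthr' : ∀ x, x ∉ Set.range e → ∀ i, ω (e i) < ω x := fun x hxr i => hthr x hxr i
  obtain ⟨t₀, ht₀⟩ := exists_eval_det_hiddenSum_ne_zero A B ω e he hthr' hAe hBe
  -- the witness: per-piece combined tables on `Fin (h + h)`, weights `λ_{pk} = t₀ ^ wt p k`, `κ_p = t₀ ^ W p`
  set tab : Fin m → Option (Fin K) → Fin (h + h) → ℂ :=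
    fun p o v => Fin.addCases (tx p o) (ty p o) v with htab
  set lam : Fin m → Fin K → ℂ := fun p k => t₀ ^ wt p k with hlam
  set kap : Fin m → ℂ := fun p => t₀ ^ W p with hkap
  set F : MvPolynomial (Fin (h + h)) ℂ := ∑ p : Fin m, C (kap p) *
    ((∏ v : Fin (h + h), (1 + C (tab p none v) * X v)) *
      ∏ k : Fin K, (1 + C (lam p k) * ∏ v : Fin (h + h), (1 + C (tab p (some k) v) * X v))) with hF
  obtain ⟨hdeg, hcoeff, hsize⟩ := truncation_spec F (h + h)
  refine ⟨∑ d ∈ Finset.range (h + h + 1), homogeneousComponent d F, hdeg, ?_, ?_⟩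
  · exact hsize.trans (by have := complexity_joinWitness_le tab lam kap; rw [← hF] at this; gcongr)
  · have hmat : (Matrix.of fun i j : Fin r => MvPolynomial.coeff
        (∑ a ∈ u i, Finsupp.single (Fin.castAdd h a) 1 +
          ∑ c ∈ w j, Finsupp.single (Fin.natAdd h c) 1)
        (∑ d ∈ Finset.range (h + h + 1), homogeneousComponent d F)) =
        Matrix.of fun i j : Fin r => ∑ x : Fin m × Finset (Fin K), A i x * B j x * t₀ ^ ω x := by
      refine Matrix.ext fun i j => ?_
      rw [Matrix.of_apply, Matrix.of_apply, hcoeff _ (degree_partitionExpo_le _ _), hF,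
        coeff_partition_joinWitness, Fintype.sum_prod_type]
      refine Finset.sum_congr rfl fun p _ => Finset.sum_congr rfl fun J _ => ?_
      have hl : ∏ k ∈ J, lam p k = t₀ ^ (∑ k ∈ J, wt p k) := by
        rw [hlam]; exact Finset.prod_pow_eq_pow_sum J (wt p) t₀
      have hk : kap p * t₀ ^ (∑ k ∈ J, wt p k) = t₀ ^ ω (p, J) := by
        rw [hkap, hω, pow_add]
      rw [hl, hA, hB]
      simp only [Matrix.of_apply, htab, Fin.addCases_left, Fin.addCases_right]
      rw [← hk]
      ring
    rw [hmat]
    exact ht₀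

/-- **THE JOIN DOOR (class form).** With `m ≤ 2h` pieces of `K ≤ 2h` hidden states each and `h ≥ 3` the
witness lies in `SmallCircuits ℂ (h+h) 7`. -/
theorem partitionMinor_hit_of_hiddenJoin_mem (h m K r : ℕ) (hh : 3 ≤ h) (hm : m ≤ h + h) (hK : K ≤ h + h)
    (u w : Fin r → Finset (Fin h))
    (e : Fin r → Fin m × Finset (Fin K)) (he : Function.Injective e) (W : Fin m → ℕ) (wt : Fin m → Fin K → ℕ)
    (hthr : ∀ x : Fin m × Finset (Fin K), x ∉ Set.range e →
      ∀ i, W (e i).1 + ∑ k ∈ (e i).2, wt (e i).1 k < W x.1 + ∑ k ∈ x.2, wt x.1 k)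
    (tx ty : Fin m → Option (Fin K) → Fin h → ℂ)
    (hx : (Matrix.of fun i k : Fin r =>
      ∏ a ∈ u i, (tx (e k).1 none a + ∑ q ∈ (e k).2, tx (e k).1 (some q) a)).det ≠ 0)
    (hy : (Matrix.of fun j k : Fin r =>
      ∏ c ∈ w j, (ty (e k).1 none c + ∑ q ∈ (e k).2, ty (e k).1 (some q) c)).det ≠ 0) :
    ∃ f ∈ SmallCircuits ℂ (h + h) 7,
      (Matrix.of fun i j : Fin r => MvPolynomial.coeff
        (∑ a ∈ u i, Finsupp.single (Fin.castAdd h a) 1 +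
          ∑ c ∈ w j, Finsupp.single (Fin.natAdd h c) 1) f).det ≠ 0 := by
  obtain ⟨f, hdeg, hsize, hf⟩ := partitionMinor_hit_of_hiddenJoin h m K r u w e he W wt hthr tx ty hx hy
  refine ⟨f, ⟨hdeg, hsize.trans ?_⟩, hf⟩
  have hsq : 3 * 3 ≤ h * h := Nat.mul_le_mul hh hh
  have e1 : h + h + 2 ≤ 3 * h := by omega
  have eK : K * (3 * (h + h) + 2) + K ≤ (h + h) * (3 * (h + h) + 2) + (h + h) := by gcongr
  have eS : 3 * (h + h) + (K * (3 * (h + h) + 2) + K) + 1 + 2 ≤ 31 * (h * h) := by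
    have : 3 * (h + h) + ((h + h) * (3 * (h + h) + 2) + (h + h)) + 1 + 2 = 12 * (h * h) + 12 * h + 3 := by
      ring
    nlinarith
  have e2 : m * (3 * (h + h) + (K * (3 * (h + h) + 2) + K) + 1 + 2) + m ≤ 64 * (h * h * h) := by
    calc m * (3 * (h + h) + (K * (3 * (h + h) + 2) + K) + 1 + 2) + m
        ≤ (h + h) * (31 * (h * h)) + (h + h) := by gcongr
      _ ≤ 64 * (h * h * h) := by nlinarith
  have e3 : h + h + 1 ≤ h * h * h := by nlinarith
  calc (h + h + 2) ^ 2 * (m * (3 * (h + h) + (K * (3 * (h + h) + 2) + K) + 1 + 2) + m) + (h + h + 1)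
      ≤ (3 * h) ^ 2 * (64 * (h * h * h)) + h * h * h := by gcongr
    _ = (576 * (h * h) + 1) * (h * h * h) := by ring
    _ ≤ (128 * (h * h) * (h * h)) * (h * h * h) := by
        apply Nat.mul_le_mul_right
        nlinarith
    _ = (h + h) ^ 7 := by ring

/-- **Item 19717 modulo ONE UNIVERSAL JOIN FAMILY per size.** Suppose that for every `h ≥ h₁` and every
`r ≤ 2^h` there are `m, K ≤ 2h`, weights and an injective threshold family `e : Fin r → Fin m × Finset (Fin K)`
of the disjoint union of `m` hidden `K`-cubes (a JOIN of per-cube threshold families, total size `r`) against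
which EVERY injective family `u : Fin r → Finset (Fin h)` has a nonsingular block-additive matrix for some
table. Then `PartitionMinorsHitByVP` holds (`b = 7`, from `max h₁ 3` on): both sides of a layout are certified
against the SAME join family and the join door applies. (The seat's candidate: the greedy join of COMPLETE
Hamming balls `B_{s_i}(K_i)`, `h ≤ K_i ≤ 2h`, plus a simplex — no partial layer anywhere.) -/
theorem partitionMinorsHitByVP_of_universalJoin (h₁ : ℕ)
    (H : ∀ h : ℕ, h₁ ≤ h → ∀ r : ℕ, r ≤ 2 ^ h →
      ∃ (m K : ℕ) (W : Fin m → ℕ) (wt : Fin m → Fin K → ℕ) (e : Fin r → Fin m × Finset (Fin K)),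
        m ≤ h + h ∧ K ≤ h + h ∧ Function.Injective e ∧
        (∀ x : Fin m × Finset (Fin K), x ∉ Set.range e →
          ∀ i, W (e i).1 + ∑ k ∈ (e i).2, wt (e i).1 k < W x.1 + ∑ k ∈ x.2, wt x.1 k) ∧
        ∀ u : Fin r → Finset (Fin h), Function.Injective u →
          ∃ tx : Fin m → Option (Fin K) → Fin h → ℂ,
            (Matrix.of fun i k : Fin r =>
              ∏ a ∈ u i, (tx (e k).1 none a + ∑ q ∈ (e k).2, tx (e k).1 (some q) a)).det ≠ 0) :
    Summit.ValiantsHypothesis.ValiantsHypothesis.Theses.BarrierLever.PartitionMinorsHitByVP := by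
  refine ⟨7, max h₁ 3, fun h hh r u w hu hw => ?_⟩
  have hh₁ : h₁ ≤ h := le_trans (le_max_left _ _) hh
  have hh2 : 3 ≤ h := le_trans (le_max_right _ _) hh
  have hr : r ≤ 2 ^ h := by
    have := Fintype.card_le_of_injective u hu
    rwa [Fintype.card_fin, Fintype.card_finset, Fintype.card_fin] at this
  obtain ⟨m, K, W, wt, e, hm, hK, he, hthr, Hu⟩ := H h hh₁ r hr
  obtain ⟨tx, hx⟩ := Hu u hu
  obtain ⟨ty, hy⟩ := Hu w hw
  exact partitionMinor_hit_of_hiddenJoin_mem h m K r hh2 hm hK u w e he W wt hthr tx ty hx hy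

/-- **THE JOIN DOOR (class form, many pieces).** With `m ≤ h·h` pieces of `K ≤ 2h` hidden states each and
`h ≥ 3` the witness lies in `SmallCircuits ℂ (h+h) 8`. (The greedy join of complete balls with `K ∈ {h, h+1}`
— the range in which no family is known to fail — may need about `h log h` pieces; `h·h` is a safe budget.) -/
theorem partitionMinor_hit_of_hiddenJoin_mem' (h m K r : ℕ) (hh : 3 ≤ h) (hm : m ≤ h * h) (hK : K ≤ h + h)
    (u w : Fin r → Finset (Fin h))
    (e : Fin r → Fin m × Finset (Fin K)) (he : Function.Injective e) (W : Fin m → ℕ) (wt : Fin m → Fin K → ℕ)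
    (hthr : ∀ x : Fin m × Finset (Fin K), x ∉ Set.range e →
      ∀ i, W (e i).1 + ∑ k ∈ (e i).2, wt (e i).1 k < W x.1 + ∑ k ∈ x.2, wt x.1 k)
    (tx ty : Fin m → Option (Fin K) → Fin h → ℂ)
    (hx : (Matrix.of fun i k : Fin r =>
      ∏ a ∈ u i, (tx (e k).1 none a + ∑ q ∈ (e k).2, tx (e k).1 (some q) a)).det ≠ 0)
    (hy : (Matrix.of fun j k : Fin r =>
      ∏ c ∈ w j, (ty (e k).1 none c + ∑ q ∈ (e k).2, ty (e k).1 (some q) c)).det ≠ 0) :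
    ∃ f ∈ SmallCircuits ℂ (h + h) 8,
      (Matrix.of fun i j : Fin r => MvPolynomial.coeff
        (∑ a ∈ u i, Finsupp.single (Fin.castAdd h a) 1 +
          ∑ c ∈ w j, Finsupp.single (Fin.natAdd h c) 1) f).det ≠ 0 := by
  obtain ⟨f, hdeg, hsize, hf⟩ := partitionMinor_hit_of_hiddenJoin h m K r u w e he W wt hthr tx ty hx hy
  refine ⟨f, ⟨hdeg, hsize.trans ?_⟩, hf⟩
  have hsq : 3 * 3 ≤ h * h := Nat.mul_le_mul hh hh
  have e1 : h + h + 2 ≤ 3 * h := by omega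
  have eK : K * (3 * (h + h) + 2) + K ≤ (h + h) * (3 * (h + h) + 2) + (h + h) := by gcongr
  have eS : 3 * (h + h) + (K * (3 * (h + h) + 2) + K) + 1 + 2 ≤ 31 * (h * h) := by
    have : 3 * (h + h) + ((h + h) * (3 * (h + h) + 2) + (h + h)) + 1 + 2 = 12 * (h * h) + 12 * h + 3 := by
      ring
    nlinarith
  have e2 : m * (3 * (h + h) + (K * (3 * (h + h) + 2) + K) + 1 + 2) + m ≤ 32 * (h * h) * (h * h) := by
    calc m * (3 * (h + h) + (K * (3 * (h + h) + 2) + K) + 1 + 2) + m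
        ≤ (h * h) * (31 * (h * h)) + (h * h) := by gcongr
      _ ≤ 32 * (h * h) * (h * h) := by nlinarith
  have e3 : h + h + 1 ≤ h * h * h := by nlinarith
  calc (h + h + 2) ^ 2 * (m * (3 * (h + h) + (K * (3 * (h + h) + 2) + K) + 1 + 2) + m) + (h + h + 1)
      ≤ (3 * h) ^ 2 * (32 * (h * h) * (h * h)) + h * h * h := by gcongr
    _ = (288 * (h * h * h) + 1) * (h * h * h) := by ring
    _ ≤ (256 * (h * h * h) * (h * h)) * (h * h * h) := by
        apply Nat.mul_le_mul_right
        nlinarith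
    _ = (h + h) ^ 8 := by ring

/-- **Item 19717 modulo ONE UNIVERSAL JOIN FAMILY per size (many pieces).** As
`partitionMinorsHitByVP_of_universalJoin`, with up to `h·h` pieces (`b = 8`). -/
theorem partitionMinorsHitByVP_of_universalJoin' (h₁ : ℕ)
    (H : ∀ h : ℕ, h₁ ≤ h → ∀ r : ℕ, r ≤ 2 ^ h →
      ∃ (m K : ℕ) (W : Fin m → ℕ) (wt : Fin m → Fin K → ℕ) (e : Fin r → Fin m × Finset (Fin K)),
        m ≤ h * h ∧ K ≤ h + h ∧ Function.Injective e ∧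
        (∀ x : Fin m × Finset (Fin K), x ∉ Set.range e →
          ∀ i, W (e i).1 + ∑ k ∈ (e i).2, wt (e i).1 k < W x.1 + ∑ k ∈ x.2, wt x.1 k) ∧
        ∀ u : Fin r → Finset (Fin h), Function.Injective u →
          ∃ tx : Fin m → Option (Fin K) → Fin h → ℂ,
            (Matrix.of fun i k : Fin r =>
              ∏ a ∈ u i, (tx (e k).1 none a + ∑ q ∈ (e k).2, tx (e k).1 (some q) a)).det ≠ 0) :
    Summit.ValiantsHypothesis.ValiantsHypothesis.Theses.BarrierLever.PartitionMinorsHitByVP := by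
  refine ⟨8, max h₁ 3, fun h hh r u w hu hw => ?_⟩
  have hh₁ : h₁ ≤ h := le_trans (le_max_left _ _) hh
  have hh2 : 3 ≤ h := le_trans (le_max_right _ _) hh
  have hr : r ≤ 2 ^ h := by
    have := Fintype.card_le_of_injective u hu
    rwa [Fintype.card_fin, Fintype.card_finset, Fintype.card_fin] at this
  obtain ⟨m, K, W, wt, e, hm, hK, he, hthr, Hu⟩ := H h hh₁ r hr
  obtain ⟨tx, hx⟩ := Hu u hu
  obtain ⟨ty, hy⟩ := Hu w hw
  exact partitionMinor_hit_of_hiddenJoin_mem' h m K r hh2 hm hK u w e he W wt hthr tx ty hx hy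

end Join

end

end Summit.ValiantsHypothesis.ValiantsHypothesis.Theorems.BarrierLever.HiddenStates
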